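import Mathlib
import HarnessLib

/-!
# Polyhedral cells over the base plane: columns, gaps and the local cone at a boundary point

(Line `janus-bands`, crux `ArrangementNormalForm`, stub `stub_separateThreeZero`, part `HICone` of
the termwise numerator split `separateThree_hI` under the rim condition.)

The domain of a terminal piece, read in the sheared coordinates `(v, w)` (`v ∈ Fin 2 → ℝ` the base
point, `w = y − ℓ(x′)` the pole coordinate), is an open polyhedral cell
`Ω = {p | ∀ j, 0 < cval (g j) p}` cut out by finitely many affine constraints. This part collects
its elementary geometry: convexity and the closure inequalities; the COLUMN LEMMA (two points of the
closed cell on a vertical line force all nearby fibres to contain a fixed interval,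
`column_interval`); the GAP LEMMA (a compact set missing a closed part of a vertical line stays
away from it, `exists_gap`); and the LOCAL CONE at a point `(v₀, 0)` of the closed cell: inactive
constraints are slack nearby (`exists_slack`), the cell is the cone of the active constraints
(`mem_Om3_iff_act`), points of the closed cone are adherent (`closure_of_active_nonneg`, registered
as `separateThree_cone`), and a degenerate closed fibre `{0}` over `v₀` forces active constraints
of both vertical orientations (`exists_active_top`, `exists_active_bot`).
-/

noncomputable section

open Set Filter Topology

namespace Summit.KontsevichZagierPeriods.ArrangementNormalForm.JanusBands

namespace SepThree

/-! ### Affine constraints -/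

/-- An affine constraint on `(Fin 2 → ℝ) × ℝ`: `(a, c, d)` stands for `p ↦ a • p.1 + c p.2 + d`. -/
abbrev Con := (Fin 2 → ℝ) × ℝ × ℝ

/-- The value of a constraint at a point. -/
def cval (t : Con) (p : (Fin 2 → ℝ) × ℝ) : ℝ := t.1 0 * p.1 0 + t.1 1 * p.1 1 + t.2.1 * p.2 + t.2.2

/-- The linear part of a constraint. -/
def clin (t : Con) (q : (Fin 2 → ℝ) × ℝ) : ℝ := t.1 0 * q.1 0 + t.1 1 * q.1 1 + t.2.1 * q.2

/-- The open polyhedral cell cut out by the constraints `g`. -/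
def Om3 {J : ℕ} (g : Fin J → Con) : Set ((Fin 2 → ℝ) × ℝ) := {p | ∀ j, 0 < cval (g j) p}

/-- The constraints active at the point `(v₀, 0)`. -/
def act {J : ℕ} (g : Fin J → Con) (v₀ : Fin 2 → ℝ) : Finset (Fin J) :=
  Finset.univ.filter fun j => cval (g j) (v₀, 0) = 0

/-- Membership in the active set. -/
theorem mem_act {J : ℕ} {g : Fin J → Con} {v₀ : Fin 2 → ℝ} {j : Fin J} :
    j ∈ act g v₀ ↔ cval (g j) (v₀, 0) = 0 := by
  simp [act]

/-- A constraint is continuous. -/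
theorem continuous_cval (t : Con) : Continuous (cval t) := by unfold cval; fun_prop

/-- The linear part is continuous. -/
theorem continuous_clin (t : Con) : Continuous (clin t) := by unfold clin; fun_prop

/-- Shifting the base point: `cval ((v₀, 0) + q) = cval (v₀, 0) + clin q`. -/
theorem cval_shift (t : Con) (v₀ : Fin 2 → ℝ) (q : (Fin 2 → ℝ) × ℝ) :
    cval t ((v₀, 0) + q) = cval t (v₀, 0) + clin t q := by
  simp only [cval, clin, Prod.fst_add, Prod.snd_add, Pi.add_apply, zero_add]
  ring

/-- The linear part is linear: scalars. -/
theorem clin_smul (t : Con) (s : ℝ) (q : (Fin 2 → ℝ) × ℝ) : clin t (s • q) = s * clin t q := by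
  simp only [clin, Prod.smul_fst, Prod.smul_snd, Pi.smul_apply, smul_eq_mul]
  ring

/-- The linear part is linear: sums. -/
theorem clin_add (t : Con) (q q' : (Fin 2 → ℝ) × ℝ) : clin t (q + q') = clin t q + clin t q' := by
  simp only [clin, Prod.fst_add, Prod.snd_add, Pi.add_apply]
  ring

/-- A constraint along a segment. -/
theorem cval_combo (t : Con) (p q : (Fin 2 → ℝ) × ℝ) {a b : ℝ} (hab : a + b = 1) :
    cval t (a • p + b • q) = a * cval t p + b * cval t q := by
  simp only [cval, Prod.fst_add, Prod.snd_add, Pi.add_apply, Prod.smul_fst, Prod.smul_snd,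
    Pi.smul_apply, smul_eq_mul]
  linear_combination (-t.2.2) * hab

/-- Coordinates are bounded by the sup norm: base coordinates. -/
theorem abs_fst_apply_le (q : (Fin 2 → ℝ) × ℝ) (i : Fin 2) : |q.1 i| ≤ ‖q‖ := by
  rw [← Real.norm_eq_abs]
  exact (norm_le_pi_norm q.1 i).trans (norm_fst_le q)

/-- Coordinates are bounded by the sup norm: pole coordinate. -/
theorem abs_snd_le (q : (Fin 2 → ℝ) × ℝ) : |q.2| ≤ ‖q‖ := by
  rw [← Real.norm_eq_abs]; exact norm_snd_le q

/-- The Lipschitz bound of the linear part. -/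
theorem abs_clin_le (t : Con) (q : (Fin 2 → ℝ) × ℝ) :
    |clin t q| ≤ (|t.1 0| + |t.1 1| + |t.2.1|) * ‖q‖ := by
  unfold clin
  have h0 := abs_fst_apply_le q 0
  have h1 := abs_fst_apply_le q 1
  have h2 := abs_snd_le q
  calc |t.1 0 * q.1 0 + t.1 1 * q.1 1 + t.2.1 * q.2|
      ≤ |t.1 0 * q.1 0| + |t.1 1 * q.1 1| + |t.2.1 * q.2| := abs_add_three _ _ _
    _ = |t.1 0| * |q.1 0| + |t.1 1| * |q.1 1| + |t.2.1| * |q.2| := by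
        rw [abs_mul, abs_mul, abs_mul]
    _ ≤ |t.1 0| * ‖q‖ + |t.1 1| * ‖q‖ + |t.2.1| * ‖q‖ := by gcongr
    _ = (|t.1 0| + |t.1 1| + |t.2.1|) * ‖q‖ := by ring

/-- A uniform positive lower bound for finitely many positive reals. -/
theorem exists_pos_le_all {ι : Type*} [Fintype ι] (f : ι → ℝ) (hf : ∀ i, 0 < f i) :
    ∃ δ > 0, ∀ i, δ ≤ f i := by
  rcases isEmpty_or_nonempty ι with h | h
  · exact ⟨1, one_pos, fun i => (IsEmpty.false i).elim⟩
  · refine ⟨Finset.univ.inf' Finset.univ_nonempty f, ?_, fun i => Finset.inf'_le f (Finset.mem_univ i)⟩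
    exact (Finset.lt_inf'_iff _).2 fun i _ => hf i

/-! ### The open cell -/

section Cell

variable {J : ℕ} (g : Fin J → Con)

/-- The cell is open. -/
theorem isOpen_Om3 : IsOpen (Om3 g) := by
  have : Om3 g = ⋂ j, {p | 0 < cval (g j) p} := by ext p; simp [Om3]
  rw [this]
  exact isOpen_iInter_of_finite fun j => isOpen_lt continuous_const (continuous_cval _)

/-- The cell is measurable. -/
theorem measurableSet_Om3 : MeasurableSet (Om3 g) := (isOpen_Om3 g).measurableSet

/-- The cell is convex. -/
theorem convex_Om3 : Convex ℝ (Om3 g) := by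
  intro p hp q hq a b ha hb hab j
  rw [cval_combo _ _ _ hab]
  rcases ha.lt_or_eq with ha' | ha'
  · exact add_pos_of_pos_of_nonneg (mul_pos ha' (hp j)) (mul_nonneg hb (hq j).le)
  · subst ha'
    rw [zero_add] at hab
    subst hab
    simpa using hq j

/-- On the closed cell all constraints are non-negative. -/
theorem cval_nonneg_of_mem_closure {p : (Fin 2 → ℝ) × ℝ} (hp : p ∈ closure (Om3 g)) (j : Fin J) :
    0 ≤ cval (g j) p :=
  closure_minimal (fun q (hq : q ∈ Om3 g) => (hq j).le)
    (isClosed_le continuous_const (continuous_cval _)) hp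

end Cell

/-! ### Columns and gaps -/

section Column

variable {J : ℕ} (g : Fin J → Con)

/-- **Column lemma.** If the closed cell contains two points `(v₀, wa)`, `(v₀, wb)` of a vertical
line, then every fibre of the cell near `v₀` contains any fixed `[a₀, b₀] ⊂ (wa, wb)`. -/
theorem column_interval {v₀ : Fin 2 → ℝ} {wa wb a₀ b₀ : ℝ}
    (ha : (v₀, wa) ∈ closure (Om3 g)) (hb : (v₀, wb) ∈ closure (Om3 g))
    (h1 : wa < a₀) (h2 : a₀ ≤ b₀) (h3 : b₀ < wb) :
    ∃ δ > 0, ∀ p ∈ Om3 g, ‖p.1 - v₀‖ < δ → ∀ w ∈ Icc a₀ b₀, (p.1, w) ∈ Om3 g := by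
  -- the margin of constraint `j` on the column
  set m : Fin J → ℝ := fun j => min (cval (g j) (v₀, a₀)) (cval (g j) (v₀, b₀)) with hm
  set L : Fin J → ℝ := fun j => |(g j).1 0| + |(g j).1 1| + 1 with hL
  have hL0 : ∀ j, 0 < L j := fun j => by simp only [hL]; positivity
  have hm0 : ∀ j, (g j).2.1 ≠ 0 → 0 < m j := by
    intro j hc
    have hwa := cval_nonneg_of_mem_closure g ha j
    have hwb := cval_nonneg_of_mem_closure g hb j
    simp only [cval] at hwa hwb
    simp only [hm, cval, lt_min_iff]
    rcases lt_or_gt_of_ne hc with hc' | hc'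
    · constructor <;> nlinarith
    · constructor <;> nlinarith
  set δ' : Fin J → ℝ := fun j => if (g j).2.1 ≠ 0 then m j / L j else 1 with hδ'
  have hδ'0 : ∀ j, 0 < δ' j := fun j => by
    simp only [hδ']
    split_ifs with hc
    · exact div_pos (hm0 j hc) (hL0 j)
    · exact one_pos
  obtain ⟨δ, hδ0, hδ⟩ := exists_pos_le_all δ' hδ'0
  refine ⟨δ, hδ0, fun p hp hpv w hw j => ?_⟩
  by_cases hc : (g j).2.1 = 0
  · -- a vertical constraint does not see `w`
    have := hp j
    simp only [cval, hc, zero_mul, add_zero] at this ⊢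
    exact this
  · have hδj : ‖p.1 - v₀‖ < m j / L j := by
      have := hδ j
      simp only [hδ', if_pos hc] at this
      exact hpv.trans_le this
    -- the value at `(v₀, w)` is at least the margin
    have hmw : m j ≤ cval (g j) (v₀, w) := by
      simp only [hm, cval]
      rcases le_or_gt 0 ((g j).2.1) with hc' | hc'
      · refine (min_le_left _ _).trans ?_
        nlinarith [hw.1]
      · refine (min_le_right _ _).trans ?_
        nlinarith [hw.2]
    -- and moving the base point costs at most `L ‖p.1 - v₀‖`
    have hdiff : |cval (g j) (p.1, w) - cval (g j) (v₀, w)| ≤ (L j - 1) * ‖p.1 - v₀‖ := by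
      have e : cval (g j) (p.1, w) - cval (g j) (v₀, w) =
          (g j).1 0 * (p.1 - v₀) 0 + (g j).1 1 * (p.1 - v₀) 1 := by
        simp only [cval, Pi.sub_apply]; ring
      rw [e]
      have h0 : |(p.1 - v₀) 0| ≤ ‖p.1 - v₀‖ := by
        rw [← Real.norm_eq_abs]; exact norm_le_pi_norm _ 0
      have h1' : |(p.1 - v₀) 1| ≤ ‖p.1 - v₀‖ := by
        rw [← Real.norm_eq_abs]; exact norm_le_pi_norm _ 1
      calc |(g j).1 0 * (p.1 - v₀) 0 + (g j).1 1 * (p.1 - v₀) 1|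
          ≤ |(g j).1 0 * (p.1 - v₀) 0| + |(g j).1 1 * (p.1 - v₀) 1| := abs_add_le _ _
        _ = |(g j).1 0| * |(p.1 - v₀) 0| + |(g j).1 1| * |(p.1 - v₀) 1| := by
            rw [abs_mul, abs_mul]
        _ ≤ |(g j).1 0| * ‖p.1 - v₀‖ + |(g j).1 1| * ‖p.1 - v₀‖ := by gcongr
        _ = (L j - 1) * ‖p.1 - v₀‖ := by simp only [hL]; ring
    have hLm : (L j - 1) * ‖p.1 - v₀‖ < m j := by
      have h4 : (L j - 1) * ‖p.1 - v₀‖ ≤ L j * ‖p.1 - v₀‖ :=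
        mul_le_mul_of_nonneg_right (by linarith) (norm_nonneg _)
      have h5 : L j * ‖p.1 - v₀‖ < L j * (m j / L j) := mul_lt_mul_of_pos_left hδj (hL0 j)
      rw [mul_div_cancel₀ _ (hL0 j).ne'] at h5
      exact h4.trans_lt h5
    rw [abs_le] at hdiff
    linarith [hdiff.1]

/-- **Gap lemma.** A compact set missing the closed part `{v₀} × T` of a vertical line stays at a
positive horizontal distance from it. -/
theorem exists_gap {K : Set ((Fin 2 → ℝ) × ℝ)} (hK : IsCompact K) {T : Set ℝ} (hT : IsClosed T)
    (v₀ : Fin 2 → ℝ) (h : ∀ w ∈ T, (v₀, w) ∉ K) :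
    ∃ δ > 0, ∀ p ∈ K, p.2 ∈ T → δ ≤ ‖p.1 - v₀‖ := by
  set K' := K ∩ Prod.snd ⁻¹' T with hK'
  have hK'c : IsCompact K' := hK.inter_right (hT.preimage continuous_snd)
  rcases K'.eq_empty_or_nonempty with he | hne
  · refine ⟨1, one_pos, fun p hp hpT => ?_⟩
    have : p ∈ K' := ⟨hp, hpT⟩
    rw [he] at this
    exact this.elim
  · have hcont : ContinuousOn (fun p : (Fin 2 → ℝ) × ℝ => ‖p.1 - v₀‖) K' := by fun_prop
    obtain ⟨pm, hpm, hmin⟩ := hK'c.exists_isMinOn hne hcont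
    have hpos : 0 < ‖pm.1 - v₀‖ := by
      rw [norm_pos_iff, sub_ne_zero]
      intro heq
      have : (v₀, pm.2) ∈ K := by rw [← heq]; exact hpm.1
      exact h pm.2 hpm.2 this
    exact ⟨‖pm.1 - v₀‖, hpos, fun p hp hpT => hmin ⟨hp, hpT⟩⟩

end Column

/-! ### The local cone at a point `(v₀, 0)` of the closed cell -/

section LocalCone

variable {J : ℕ} (g : Fin J → Con) (v₀ : Fin 2 → ℝ)

/-- **Slack.** Near a point `(v₀, 0)` of the closed cell the inactive constraints are positive. -/
theorem exists_slack (h0 : ∀ j, 0 ≤ cval (g j) (v₀, 0)) :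
    ∃ r₀ > 0, ∀ q : (Fin 2 → ℝ) × ℝ, ‖q‖ < r₀ → ∀ j, j ∉ act g v₀ → 0 < cval (g j) ((v₀, 0) + q) := by
  set L : Fin J → ℝ := fun j => |(g j).1 0| + |(g j).1 1| + |(g j).2.1| + 1 with hL
  have hL0 : ∀ j, 0 < L j := fun j => by simp only [hL]; positivity
  set r : Fin J → ℝ := fun j => if j ∈ act g v₀ then 1 else cval (g j) (v₀, 0) / L j with hr
  have hr0 : ∀ j, 0 < r j := fun j => by
    simp only [hr]
    split_ifs with hj
    · exact one_pos
    · exact div_pos ((h0 j).lt_of_ne (fun h => hj (mem_act.2 h.symm))) (hL0 j)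
  obtain ⟨r₀, hr₀, hle⟩ := exists_pos_le_all r hr0
  refine ⟨r₀, hr₀, fun q hq j hj => ?_⟩
  have hqr : ‖q‖ < cval (g j) (v₀, 0) / L j := by
    have := hle j
    simp only [hr, if_neg hj] at this
    exact hq.trans_le this
  rw [cval_shift]
  have hcl := abs_clin_le (g j) q
  have h1 : (|(g j).1 0| + |(g j).1 1| + |(g j).2.1|) * ‖q‖ ≤ L j * ‖q‖ :=
    mul_le_mul_of_nonneg_right (by simp only [hL]; linarith) (norm_nonneg _)
  have h2 : L j * ‖q‖ < cval (g j) (v₀, 0) := by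
    have := mul_lt_mul_of_pos_left hqr (hL0 j)
    rwa [mul_div_cancel₀ _ (hL0 j).ne'] at this
  rw [abs_le] at hcl
  linarith [hcl.1]

/-- **The local cone.** Near a point `(v₀, 0)` of the closed cell, membership in the cell is
decided by the active constraints, which are linear in the centred coordinates. -/
theorem mem_Om3_iff_act (h0 : ∀ j, 0 ≤ cval (g j) (v₀, 0)) :
    ∃ r₀ > 0, ∀ q : (Fin 2 → ℝ) × ℝ, ‖q‖ < r₀ →
      ((v₀, 0) + q ∈ Om3 g ↔ ∀ j ∈ act g v₀, 0 < clin (g j) q) := by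
  obtain ⟨r₀, hr₀, hs⟩ := exists_slack g v₀ h0
  refine ⟨r₀, hr₀, fun q hq => ⟨fun h j hj => ?_, fun h j => ?_⟩⟩
  · have := h j
    rwa [cval_shift, mem_act.1 hj, zero_add] at this
  · by_cases hj : j ∈ act g v₀
    · rw [cval_shift, mem_act.1 hj, zero_add]; exact h j hj
    · exact hs q hq j hj

/-- **Points of the closed local cone are adherent to the cell.** -/
theorem closure_of_active_nonneg (hcl : ((v₀, 0) : (Fin 2 → ℝ) × ℝ) ∈ closure (Om3 g)) :
    ∃ r₁ > 0, ∀ q : (Fin 2 → ℝ) × ℝ, ‖q‖ < r₁ → (∀ j ∈ act g v₀, 0 ≤ clin (g j) q) →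
      (v₀, 0) + q ∈ closure (Om3 g) := by
  have h0 := cval_nonneg_of_mem_closure g hcl
  obtain ⟨r₀, hr₀, hs⟩ := exists_slack g v₀ h0
  -- a point of the cell near `(v₀, 0)`
  obtain ⟨ps, hps, hdist⟩ := Metric.mem_closure_iff.1 hcl (r₀ / 2) (half_pos hr₀)
  set qs : (Fin 2 → ℝ) × ℝ := ps - (v₀, 0) with hqs
  have hqs_eq : (v₀, 0) + qs = ps := by rw [hqs]; abel
  have hqs_norm : ‖qs‖ < r₀ / 2 := by
    rw [hqs, ← dist_eq_norm, dist_comm]; exact hdist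
  have hqs_pos : ∀ j ∈ act g v₀, 0 < clin (g j) qs := fun j hj => by
    have := hps j
    rwa [← hqs_eq, cval_shift, mem_act.1 hj, zero_add] at this
  refine ⟨r₀ / 2, half_pos hr₀, fun q hq hnn => ?_⟩
  -- the segment from `q` to `qs`, open at `q`, lies in the cell
  set Q : ℝ → (Fin 2 → ℝ) × ℝ := fun t => (v₀, 0) + ((1 - t) • q + t • qs) with hQ
  have hQmem : ∀ t ∈ Ioc (0 : ℝ) 1, Q t ∈ Om3 g := by
    intro t ht j
    by_cases hj : j ∈ act g v₀
    · rw [hQ, cval_shift, mem_act.1 hj, zero_add, clin_add, clin_smul, clin_smul]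
      exact add_pos_of_nonneg_of_pos (mul_nonneg (by linarith [ht.2]) (hnn j hj))
        (mul_pos ht.1 (hqs_pos j hj))
    · refine hs _ ?_ j hj
      calc ‖(1 - t) • q + t • qs‖ ≤ ‖(1 - t) • q‖ + ‖t • qs‖ := norm_add_le _ _
        _ = (1 - t) * ‖q‖ + t * ‖qs‖ := by
            rw [norm_smul, norm_smul, Real.norm_eq_abs, Real.norm_eq_abs,
              abs_of_nonneg (by linarith [ht.2]), abs_of_pos ht.1]
        _ < (1 - t) * (r₀ / 2) + t * (r₀ / 2) + (r₀ / 2) := by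
            nlinarith [norm_nonneg q, norm_nonneg qs, ht.1, ht.2]
        _ = r₀ := by ring
  have hQcont : Continuous Q := by simp only [hQ]; fun_prop
  have hQ0 : Q 0 = (v₀, 0) + q := by simp [hQ]
  rw [← hQ0]
  have ht : Tendsto Q (𝓝[>] 0) (𝓝 (Q 0)) := (hQcont.tendsto 0).mono_left nhdsWithin_le_nhds
  refine mem_closure_of_tendsto ht ?_
  filter_upwards [Ioc_mem_nhdsGT (zero_lt_one' ℝ)] with t ht
  exact hQmem t ht

/-- **A degenerate closed fibre forces an active constraint bounding `w` from above.** -/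
theorem exists_active_top (hcl : ((v₀, 0) : (Fin 2 → ℝ) × ℝ) ∈ closure (Om3 g))
    (hZ : ∀ w : ℝ, ((v₀, w) : (Fin 2 → ℝ) × ℝ) ∈ closure (Om3 g) → w = 0) :
    ∃ j ∈ act g v₀, (g j).2.1 < 0 := by
  by_contra hall
  push Not at hall
  obtain ⟨r₁, hr₁, hc⟩ := closure_of_active_nonneg g v₀ hcl
  have hmem := hc ((0 : Fin 2 → ℝ), r₁ / 2) (by
    rw [Prod.norm_def, norm_zero, Real.norm_eq_abs, abs_of_pos (half_pos hr₁), max_eq_right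
      (half_pos hr₁).le]
    exact half_lt_self hr₁) (fun j hj => by
    simp only [clin, Pi.zero_apply, mul_zero, zero_add]
    exact mul_nonneg (hall j hj) (half_pos hr₁).le)
  have heq : ((v₀, 0) : (Fin 2 → ℝ) × ℝ) + (0, r₁ / 2) = (v₀, r₁ / 2) := by simp
  rw [heq] at hmem
  have := hZ _ hmem
  linarith

/-- **A degenerate closed fibre forces an active constraint bounding `w` from below.** -/
theorem exists_active_bot (hcl : ((v₀, 0) : (Fin 2 → ℝ) × ℝ) ∈ closure (Om3 g))
    (hZ : ∀ w : ℝ, ((v₀, w) : (Fin 2 → ℝ) × ℝ) ∈ closure (Om3 g) → w = 0) :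
    ∃ j ∈ act g v₀, 0 < (g j).2.1 := by
  by_contra hall
  push Not at hall
  obtain ⟨r₁, hr₁, hc⟩ := closure_of_active_nonneg g v₀ hcl
  have hmem := hc ((0 : Fin 2 → ℝ), -(r₁ / 2)) (by
    rw [Prod.norm_def, norm_zero, Real.norm_eq_abs, abs_neg, abs_of_pos (half_pos hr₁),
      max_eq_right (half_pos hr₁).le]
    exact half_lt_self hr₁) (fun j hj => by
    simp only [clin, Pi.zero_apply, mul_zero, zero_add]
    nlinarith [hall j hj, half_pos hr₁])
  have heq : ((v₀, 0) : (Fin 2 → ℝ) × ℝ) + (0, -(r₁ / 2)) = (v₀, -(r₁ / 2)) := by simp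
  rw [heq] at hmem
  have := hZ _ hmem
  linarith

end LocalCone

end SepThree

/-- **Points of the closed local cone are adherent to the cell** (registered part of
`stub_separateThreeZero`; literal form of `SepThree.closure_of_active_nonneg`): at a point
`(v₀, 0)` of the closure of the open polyhedral cell `Ω = {p | ∀ j, 0 < cval (g j) p}`, every
sufficiently small displacement `q` on which all constraints active at `(v₀, 0)` have non-negative
linear part gives a point `(v₀, 0) + q` of the closure of `Ω`. -/
theorem separateThree_cone {J : ℕ} (g : Fin J → (Fin 2 → ℝ) × ℝ × ℝ) (v₀ : Fin 2 → ℝ) (hcl : ((v₀, 0) : (Fin 2 → ℝ) × ℝ) ∈ closure (SepThree.Om3 g)) : ∃ r₁ > 0, ∀ q : (Fin 2 → ℝ) × ℝ, ‖q‖ < r₁ → (∀ j ∈ SepThree.act g v₀, 0 ≤ SepThree.clin (g j) q) → (v₀, 0) + q ∈ closure (SepThree.Om3 g) := by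
  exact SepThree.closure_of_active_nonneg g v₀ hcl

end Summit.KontsevichZagierPeriods.ArrangementNormalForm.JanusBands
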